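import Summits.NavierStokesRegularity.NavierStokesRegularity.Theorems.ArgmaxDoorsDepletion
import Literature.Analysis.FluidPDE.BiotSavartHolder
import HarnessLib

/-!
# StrainDoorsDecayTools — door family S37 «StrainDoors» (nsreg-p1 ROUND-35), plate D_S «GradientUniformDecay»: tools

S-door lane (ns-sfl-p1 g5; LEAD ns-s30-p1 g3; texts of record nsreg-p1 g31 `r35/Sketch37.lean` sha16 265cb074f1d98fd0;
`--supports stmt-NavierStokesRegularity-0056 --as helper`). Elementary tools for the pressure-free proof of D_S
(`StrainDoorsDecay`): Hölder-½ by interpolation between a Lipschitz bound and a sup bound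
(`holderWith_half_of_lipschitzWith`, Mathlib `HolderOnWith.interpolate`), the quantitative near-field cutoff
`χ_R(· − x₀)·w` (`cutoff_smul_bounds`: Lipschitz constant `L + (B/R)m`, sup `m`, support in `B̄(x₀,2R)`), and the
enstrophy of a slice from its `H¹` bound (`integral_norm_curl_sq_le_of_lintegral`).

WHAT THIS IS NOT: tools for a frame lemma serving regularity CRITERIA (doors S37-H/Π); item 0056 `NoTypeII` and NS
regularity are NOT proved; nothing here is a route or a summit statement.
-/

-- the summit's problem namespace repeats the summit name (tree layout)
set_option linter.dupNamespace false

noncomputable section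

open MeasureTheory Set Function Filter Topology Metric InnerProductSpace Real
open scoped NNReal ENNReal RealInnerProductSpace ContDiff
open Literature.Analysis Literature.Analysis.FluidPDE

namespace Summit.NavierStokesRegularity.NavierStokesRegularity.Theorems.ArgmaxDoors

/-! ### Hölder-½ by interpolation; the quantitative cutoff -/

/-- **Interpolation**: a `K`-Lipschitz function bounded by `M` is `½`-Hölder with constant `K^{1/2}(2M)^{1/2}`. -/
theorem holderWith_half_of_lipschitzWith {f : EuclideanSpace ℝ (Fin 3) → EuclideanSpace ℝ (Fin 3)} {K M : ℝ≥0}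
    (hK : LipschitzWith K f) (hM : ∀ y, ‖f y‖ ≤ M) :
    HolderWith (K ^ ((1 / 2 : ℝ≥0) : ℝ) * (2 * M) ^ ((1 / 2 : ℝ≥0) : ℝ)) (1 / 2) f := by
  have h1 : HolderOnWith K 1 f univ := hK.holderWith.holderOnWith univ
  have h0 : HolderOnWith (2 * M) 0 f univ := by
    intro x _ y _
    rw [NNReal.coe_zero, ENNReal.rpow_zero, mul_one, edist_nndist, ENNReal.coe_le_coe, ← NNReal.coe_le_coe,
      coe_nndist]
    push_cast
    calc dist (f x) (f y) ≤ ‖f x‖ + ‖f y‖ := dist_le_norm_add_norm _ _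
      _ ≤ M + M := add_le_add (hM x) (hM y)
      _ = 2 * M := by ring
  have h := h1.interpolate h0 (t₁ := 1 / 2) (t₂ := 1 / 2) (by rw [← two_mul, mul_one_div_cancel two_ne_zero])
  rw [one_mul, zero_mul, add_zero] at h
  exact holderOnWith_univ.1 h

/-- The interpolated constant in real terms: `K^{1/2}(2M)^{1/2} = √(2KM)`. -/
theorem coe_interpolated_const (K M : ℝ≥0) :
    ((K ^ ((1 / 2 : ℝ≥0) : ℝ) * (2 * M) ^ ((1 / 2 : ℝ≥0) : ℝ) : ℝ≥0) : ℝ) = Real.sqrt (2 * K * M) := by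
  push_cast
  rw [Real.sqrt_eq_rpow, show ((2 : ℝ) * K * M) = K * (2 * M) by ring,
    Real.mul_rpow K.coe_nonneg (by positivity)]

/-- **The quantitative near-field cutoff**: for `w ∈ C¹` with `‖∇w‖ ≤ L` everywhere and `|w| ≤ m` on `B̄(x₀, 3R)`,
the localisation `f = χ_R(· − x₀) w` is Lipschitz with constant `L + (B/R)m`, bounded by `m`, and vanishes off
`B(x₀, 2R)` (`B` the universal cutoff-gradient constant). -/
theorem cutoff_smul_bounds {w : EuclideanSpace ℝ (Fin 3) → EuclideanSpace ℝ (Fin 3)} (hw : ContDiff ℝ 1 w)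
    {L m B : ℝ} (hL0 : 0 ≤ L) (hm0 : 0 ≤ m) (hB0 : 0 ≤ B) (hL : ∀ y, ‖fderiv ℝ w y‖ ≤ L)
    (hB : ∀ ε : ℝ, 0 < ε → ∀ z : EuclideanSpace ℝ (Fin 3), ‖fderiv ℝ (radialCutoff ε (2 * ε)) z‖ ≤ B * ε⁻¹)
    (x₀ : EuclideanSpace ℝ (Fin 3)) {R : ℝ} (hR : 0 < R) (hm : ∀ y, ‖y - x₀‖ ≤ 3 * R → ‖w y‖ ≤ m) :
    LipschitzWith (Real.toNNReal (L + B * R⁻¹ * m)) (fun y => suppCutoff x₀ R y • w y) ∧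
    (∀ y, ‖suppCutoff x₀ R y • w y‖ ≤ m) ∧
    tsupport (fun y => suppCutoff x₀ R y • w y) ⊆ closedBall x₀ (2 * R) := by
  have hχ : ContDiff ℝ 1 (suppCutoff x₀ R) := contDiff_suppCutoff x₀ R
  have hχd : Differentiable ℝ (suppCutoff x₀ R) := hχ.differentiable one_ne_zero
  have hwd : Differentiable ℝ w := hw.differentiable one_ne_zero
  have hfd : Differentiable ℝ (fun y => suppCutoff x₀ R y • w y) := hχd.smul hwd
  refine ⟨?_, ?_, ?_⟩
  · refine lipschitzWith_of_nnnorm_fderiv_le hfd fun y => ?_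
    rw [← NNReal.coe_le_coe, coe_nnnorm, Real.coe_toNNReal _ (by positivity)]
    rw [show (fun y => suppCutoff x₀ R y • w y) = suppCutoff x₀ R • w from rfl, fderiv_smul (hχd y) (hwd y)]
    have hχ1 : |suppCutoff x₀ R y| ≤ 1 := abs_suppCutoff_le_one x₀ R y
    have hDχ : ‖fderiv ℝ (suppCutoff x₀ R) y‖ ≤ B * R⁻¹ := norm_fderiv_suppCutoff_le hB x₀ hR y
    by_cases hy : ‖y - x₀‖ ≤ 3 * R
    · calc ‖suppCutoff x₀ R y • fderiv ℝ w y + (fderiv ℝ (suppCutoff x₀ R) y).smulRight (w y)‖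
          ≤ ‖suppCutoff x₀ R y • fderiv ℝ w y‖ + ‖(fderiv ℝ (suppCutoff x₀ R) y).smulRight (w y)‖ :=
            norm_add_le _ _
        _ = |suppCutoff x₀ R y| * ‖fderiv ℝ w y‖ + ‖fderiv ℝ (suppCutoff x₀ R) y‖ * ‖w y‖ := by
            rw [norm_smul, Real.norm_eq_abs, ContinuousLinearMap.norm_smulRight_apply]
        _ ≤ 1 * L + B * R⁻¹ * m := by
            gcongr
            · exact hL y
            · exact hm y hy
        _ = L + B * R⁻¹ * m := by ring
    · have hy' : 2 * R < ‖y - x₀‖ := by linarith [not_le.1 hy]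
      rw [fderiv_suppCutoff_eq_zero_of_lt hR hy', suppCutoff_eq_zero hR hy'.le, zero_smul, zero_add,
        ContinuousLinearMap.norm_smulRight_apply, norm_zero, zero_mul]
      positivity
  · intro y
    rw [norm_smul, Real.norm_eq_abs]
    by_cases hy : ‖y - x₀‖ ≤ 3 * R
    · calc |suppCutoff x₀ R y| * ‖w y‖ ≤ 1 * m :=
            mul_le_mul (abs_suppCutoff_le_one x₀ R y) (hm y hy) (norm_nonneg _) zero_le_one
        _ = m := one_mul m
    · have hy' : 2 * R ≤ ‖y - x₀‖ := by linarith [not_le.1 hy]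
      rw [suppCutoff_eq_zero hR hy', abs_zero, zero_mul]
      exact hm0
  · -- the support lies in the open ball `B(x₀, 2R)`
    have hsupp : support (fun y => suppCutoff x₀ R y • w y) ⊆ ball x₀ (2 * R) := by
      intro y hy
      rw [mem_ball, dist_eq_norm]
      by_contra hge
      exact hy (by simp only; rw [suppCutoff_eq_zero hR (not_lt.1 hge), zero_smul])
    exact (closure_mono hsupp).trans closure_ball_subset_closedBall

/-- `∫ ‖curl v‖² ≤ (‖curlCLM‖²·C₁).toReal` from the `H¹` bound `∫⁻ ‖Dv‖ₑ² ≤ C₁`. -/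
theorem integral_norm_curl_sq_le_of_lintegral {v : EuclideanSpace ℝ (Fin 3) → EuclideanSpace ℝ (Fin 3)}
    (hv : ContDiff ℝ 2 v) {C₁ : ℝ≥0} (hC₁ : ∫⁻ y, ‖iteratedFDeriv ℝ 1 v y‖ₑ ^ 2 ≤ C₁) :
    Integrable (fun y => ‖curl v y‖ ^ 2) ∧
    ∫ y, ‖curl v y‖ ^ 2 ≤ (ENNReal.ofReal (‖curlCLM‖ ^ 2) * C₁).toReal := by
  have hw1 : ContDiff ℝ 1 (curl v) := contDiff_curl (n := 1) (by exact hv)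
  have hwc : Continuous (curl v) := hw1.continuous
  have hle : ∫⁻ y, ‖curl v y‖ₑ ^ 2 ≤ ENNReal.ofReal (‖curlCLM‖ ^ 2) * C₁ :=
    (lintegral_curl_sq_le v).trans (mul_le_mul' le_rfl hC₁)
  have hlt : ∫⁻ y, ‖curl v y‖ₑ ^ 2 < ⊤ :=
    lt_of_le_of_lt hle (ENNReal.mul_lt_top ENNReal.ofReal_lt_top ENNReal.coe_lt_top)
  have hw2 : Integrable fun y => ‖curl v y‖ ^ 2 := integrable_sq_norm_of_lintegral_lt_top hwc hlt
  refine ⟨hw2, ?_⟩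
  have hne : ENNReal.ofReal (‖curlCLM‖ ^ 2) * C₁ ≠ ⊤ :=
    ENNReal.mul_ne_top ENNReal.ofReal_ne_top ENNReal.coe_ne_top
  refine (ENNReal.ofReal_le_iff_le_toReal hne).1 ?_
  rw [ofReal_integral_eq_lintegral_ofReal hw2 (Eventually.of_forall fun y => sq_nonneg _)]
  refine le_of_eq_of_le (lintegral_congr fun y => ?_) hle
  rw [ENNReal.ofReal_pow (norm_nonneg _), ofReal_norm]

end Summit.NavierStokesRegularity.NavierStokesRegularity.Theorems.ArgmaxDoors

end
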